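import Mathlib
import HarnessLib
import Literature.AlgebraicGeometry.HyperbolicPolynomials.SpectrahedralShadow
import Summits.ValiantsHypothesis.ValiantsHypothesis.Theorems.PermanentalConesHyperbolicVPShadowStubSpectrahedronOfSymmDetIdentity

/-!
# ValiantsHypothesis / PermanentalCones — `HyperbolicVPShadow`, stub E

Route `PermanentalCones`, item `stmt-ValiantsHypothesis-8655` (crux `HyperbolicVPShadow`), line
`birth`, stub `stub_highLayer_inhabited` (the "high layer" of the crux is inhabited at `N = 3`).

We exhibit an explicit integer pencil `P x = x₀ D + x₁ A + x₂ B` of real `3 × 3` matrices,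
`D = diag (0, 1, 2)`, `A = !![0, 1, 1; 2, 0, 1; 2, 2, 2]`, `B = !![0, 0, 0; -2, 0, -1; 4, 0, 2]`
(as a linear map, `P = Fintype.linearCombination ℝ ![D, A, B]`), such that

* every `P x` has only real eigenvalues — because of the determinantal identity
  `det (P x + τ·1) = det (L x + τ·1)` with the *symmetric* pencil `L x = x₀ D + x₁ S₂ + x₂ S₃`,
  `S₂ = !![0, 1, 2; 1, 0, 1; 2, 1, 2]`, `S₃ = diag (0, 0, 2)` (a polynomial identity in
  `x₀, x₁, x₂, τ`, checked by `ring` over `ℝ` and over `ℂ`), and real symmetric matrices have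
  real spectrum (`Matrix.IsHermitian.splits_charpoly`);
* the family is irreducible (no common invariant subspace other than `⊥`, `⊤`): an invariant
  subspace `W ≠ ⊥` is invariant under `D = P e₀`, hence contains the coordinate projections
  `Pi.single j (u j)` of each of its elements `u` (the eigenvalues `0, 1, 2` of `D` are distinct),
  hence some coordinate vector `eᵢ`, hence `u := A eᵢ + eᵢ` — a column of `A + 1`, all of whose
  entries are nonzero — hence all of `e₀, e₁, e₂`;
* the family is not simultaneously symmetrisable: `S ≻ 0` with `S D` and `S A` symmetric forces
  `S` to be diagonal (`S D = D S`) and then `S₀₀ = 2 S₁₁ = 2 S₂₂`, `S₁₁ = 2 S₂₂`, so `S₂₂ = 0`,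
  contradicting `0 < S₂₂`;
* `1, D, A, B` are linearly independent, so `3 < 4 ≤ dim span ({1} ∪ range P)`;
* nevertheless the closed cone `{x : ∀ τ > 0, det (P x + τ·1) ≠ 0}` is a spectrahedron of size
  `3`: the determinantal identity feeds `stub_spectrahedron_of_symmDetIdentity`.

No definitions are introduced: the five integer matrices are written out as literals throughout.
-/

-- `<Problem> = <Summit>` for this single-conjunct summit (lakefile sets the same option tree-wide).
set_option linter.dupNamespace false

namespace Summit.ValiantsHypothesis.ValiantsHypothesis.Theorems

open Matrix

/-! ## Entries of the two pencils -/

/-- Entries of `P x = x₀ D + x₁ A + x₂ B`, `D = diag (0, 1, 2)`,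
`A = !![0, 1, 1; 2, 0, 1; 2, 2, 2]`, `B = !![0, 0, 0; -2, 0, -1; 4, 0, 2]`. [folklore] -/
theorem permanentalCones_highLayer_P_apply (x : Fin 3 → ℝ) :
    Fintype.linearCombination ℝ ![(!![0, 0, 0; 0, 1, 0; 0, 0, 2] : Matrix (Fin 3) (Fin 3) ℝ),
        !![0, 1, 1; 2, 0, 1; 2, 2, 2], !![0, 0, 0; -2, 0, -1; 4, 0, 2]] x =
      !![0, x 1, x 1; 2 * x 1 - 2 * x 2, x 0, x 1 - x 2;
        2 * x 1 + 4 * x 2, 2 * x 1, 2 * x 0 + 2 * x 1 + 2 * x 2] := by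
  ext i j
  rw [Fintype.linearCombination_apply, Fin.sum_univ_three]
  fin_cases i <;> fin_cases j <;> simp <;> ring

/-- Entries of `L x = x₀ D + x₁ S₂ + x₂ S₃`, `D = diag (0, 1, 2)`,
`S₂ = !![0, 1, 2; 1, 0, 1; 2, 1, 2]`, `S₃ = diag (0, 0, 2)`. [folklore] -/
theorem permanentalCones_highLayer_L_apply (x : Fin 3 → ℝ) :
    Fintype.linearCombination ℝ ![(!![0, 0, 0; 0, 1, 0; 0, 0, 2] : Matrix (Fin 3) (Fin 3) ℝ),
        !![0, 1, 2; 1, 0, 1; 2, 1, 2], !![0, 0, 0; 0, 0, 0; 0, 0, 2]] x =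
      !![0, x 1, 2 * x 1; x 1, x 0, x 1; 2 * x 1, x 1, 2 * x 0 + 2 * x 1 + 2 * x 2] := by
  ext i j
  rw [Fintype.linearCombination_apply, Fin.sum_univ_three]
  fin_cases i <;> fin_cases j <;> simp <;> ring

/-- Every `L x` is symmetric. [folklore] -/
theorem permanentalCones_highLayer_L_isSymm (x : Fin 3 → ℝ) :
    (!![0, x 1, 2 * x 1; x 1, x 0, x 1; 2 * x 1, x 1, 2 * x 0 + 2 * x 1 + 2 * x 2] :
      Matrix (Fin 3) (Fin 3) ℝ).IsSymm :=
  Matrix.IsSymm.ext fun i j => by fin_cases i <;> fin_cases j <;> simp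

/-! ## The symmetric determinantal certificate -/

/-- The certificate over `ℝ`: `det (P x + τ·1) = det (L x + τ·1)` (both sides equal
`τ³ + (3x₀ + 2x₁ + 2x₂) τ² + (2x₀² + 2x₀x₁ + 2x₀x₂ − 6x₁²) τ − 6x₀x₁² + 2x₁³ − 2x₁²x₂`).
[folklore] -/
theorem permanentalCones_highLayer_det_eq (x : Fin 3 → ℝ) (τ : ℝ) :
    ((!![0, x 1, x 1; 2 * x 1 - 2 * x 2, x 0, x 1 - x 2;
        2 * x 1 + 4 * x 2, 2 * x 1, 2 * x 0 + 2 * x 1 + 2 * x 2] : Matrix (Fin 3) (Fin 3) ℝ) +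
        τ • (1 : Matrix (Fin 3) (Fin 3) ℝ)).det =
      ((!![0, x 1, 2 * x 1; x 1, x 0, x 1; 2 * x 1, x 1, 2 * x 0 + 2 * x 1 + 2 * x 2] :
        Matrix (Fin 3) (Fin 3) ℝ) + τ • (1 : Matrix (Fin 3) (Fin 3) ℝ)).det := by
  simp only [Fin.isValue, det_fin_three, Matrix.add_apply, of_apply, cons_val', cons_val_zero,
    cons_val_fin_one, Matrix.smul_apply, one_apply_eq, smul_eq_mul, mul_one, zero_add, cons_val_one,
    cons_val, ne_eq, Fin.reduceEq, not_false_eq_true, one_apply_ne, mul_zero, add_zero, zero_ne_one,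
    one_ne_zero]
  ring

/-- The certificate over `ℂ`: `det (P x - z·1) = det (L x - z·1)` for complex `z` (the same
polynomial identity). [folklore] -/
theorem permanentalCones_highLayer_det_map_eq (x : Fin 3 → ℝ) (z : ℂ) :
    ((!![0, x 1, x 1; 2 * x 1 - 2 * x 2, x 0, x 1 - x 2;
        2 * x 1 + 4 * x 2, 2 * x 1, 2 * x 0 + 2 * x 1 + 2 * x 2] : Matrix (Fin 3) (Fin 3) ℝ).map
          (algebraMap ℝ ℂ) - z • (1 : Matrix (Fin 3) (Fin 3) ℂ)).det =
      ((!![0, x 1, 2 * x 1; x 1, x 0, x 1; 2 * x 1, x 1, 2 * x 0 + 2 * x 1 + 2 * x 2] :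
          Matrix (Fin 3) (Fin 3) ℝ).map (algebraMap ℝ ℂ) -
        z • (1 : Matrix (Fin 3) (Fin 3) ℂ)).det := by
  simp only [Fin.isValue, Complex.coe_algebraMap, det_fin_three, Matrix.sub_apply, map_apply,
    of_apply, cons_val', cons_val_zero, cons_val_fin_one, Complex.ofReal_zero, Matrix.smul_apply,
    one_apply_eq, smul_eq_mul, mul_one, zero_sub, cons_val_one, neg_mul, cons_val,
    Complex.ofReal_add, Complex.ofReal_mul, Complex.ofReal_ofNat, Complex.ofReal_sub, ne_eq,
    Fin.reduceEq, not_false_eq_true, one_apply_ne, mul_zero, sub_zero, sub_neg_eq_add, zero_ne_one,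
    one_ne_zero]
  ring

/-! ## Real spectrum -/

/-- A real symmetric matrix has only real (complex) eigenvalues: if `det (M - z·1) = 0` over `ℂ`
then `z ∈ ℝ`. (The characteristic polynomial of a real symmetric matrix splits over `ℝ`,
`Matrix.IsHermitian.splits_charpoly`, so its complex roots are the images of its real roots.)
[folklore] -/
theorem permanentalCones_im_eq_zero_of_isSymm {N : ℕ} {M : Matrix (Fin N) (Fin N) ℝ}
    (hM : M.IsSymm) {z : ℂ}
    (hz : (M.map (algebraMap ℝ ℂ) - z • (1 : Matrix (Fin N) (Fin N) ℂ)).det = 0) :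
    z.im = 0 := by
  have hH : M.IsHermitian := Matrix.isHermitian_iff_isSymm.2 hM
  have hroot : z ∈ (M.charpoly.map (algebraMap ℝ ℂ)).roots := by
    rw [← Matrix.charpoly_map, Polynomial.mem_roots (Matrix.charpoly_monic _).ne_zero,
      Polynomial.IsRoot.def, Matrix.eval_charpoly, Matrix.scalar_apply,
      ← Matrix.smul_one_eq_diagonal, ← neg_sub, Matrix.det_neg, hz, mul_zero]
  rw [hH.splits_charpoly.roots_map_of_injective (algebraMap ℝ ℂ).injective,
    Multiset.mem_map] at hroot
  obtain ⟨r, -, rfl⟩ := hroot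
  exact Complex.ofReal_im r

/-! ## Irreducibility -/

/-- If a subspace `W ≤ ℝ³` is invariant under `D = diag (0, 1, 2)` and contains `u`, then it
contains each coordinate projection `Pi.single j (u j)` of `u` (Lagrange interpolation at the
distinct eigenvalues `0, 1, 2`). [folklore] -/
theorem permanentalCones_highLayer_single_mem (W : Submodule ℝ (Fin 3 → ℝ))
    (hW : ∀ v ∈ W, (!![0, 0, 0; 0, 1, 0; 0, 0, 2] : Matrix (Fin 3) (Fin 3) ℝ) *ᵥ v ∈ W)
    {u : Fin 3 → ℝ} (hu : u ∈ W) (j : Fin 3) : Pi.single j (u j) ∈ W := by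
  have h1 := hW u hu
  have h2 := hW _ h1
  have e1 : (!![0, 0, 0; 0, 1, 0; 0, 0, 2] : Matrix (Fin 3) (Fin 3) ℝ) *ᵥ u =
      ![0, u 1, 2 * u 2] := by
    ext k; fin_cases k <;> simp [Matrix.mulVec, dotProduct, Fin.sum_univ_three]
  have e2 : (!![0, 0, 0; 0, 1, 0; 0, 0, 2] : Matrix (Fin 3) (Fin 3) ℝ) *ᵥ ![0, u 1, 2 * u 2] =
      ![0, u 1, 4 * u 2] := by
    ext k
    fin_cases k <;> simp [Matrix.mulVec, dotProduct, Fin.sum_univ_three]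
    ring
  rw [e1] at h1 h2
  rw [e2] at h2
  -- Lagrange interpolation at the eigenvalues `0, 1, 2` of `D`
  have s0 : Pi.single (0 : Fin 3) (u 0) =
      u - (3 / 2 : ℝ) • (![0, u 1, 2 * u 2] : Fin 3 → ℝ) + (1 / 2 : ℝ) • ![0, u 1, 4 * u 2] := by
    ext k; fin_cases k <;> simp [Matrix.vecHead, Matrix.vecTail] <;> ring
  have s1 : Pi.single (1 : Fin 3) (u 1) =
      (2 : ℝ) • (![0, u 1, 2 * u 2] : Fin 3 → ℝ) - ![0, u 1, 4 * u 2] := by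
    ext k; fin_cases k <;> simp <;> ring
  have s2 : Pi.single (2 : Fin 3) (u 2) =
      (1 / 2 : ℝ) • (![0, u 1, 4 * u 2] : Fin 3 → ℝ) - (1 / 2 : ℝ) • ![0, u 1, 2 * u 2] := by
    ext k
    fin_cases k <;> simp
    ring
  have m0 : Pi.single (0 : Fin 3) (u 0) ∈ W :=
    s0 ▸ W.add_mem (W.sub_mem hu (W.smul_mem _ h1)) (W.smul_mem _ h2)
  have m1 : Pi.single (1 : Fin 3) (u 1) ∈ W := s1 ▸ W.sub_mem (W.smul_mem _ h1) h2
  have m2 : Pi.single (2 : Fin 3) (u 2) ∈ W := s2 ▸ W.sub_mem (W.smul_mem _ h2) (W.smul_mem _ h1)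
  fin_cases j
  exacts [m0, m1, m2]

/-- Rescaling a coordinate vector inside a subspace. [folklore] -/
theorem permanentalCones_highLayer_single_mem_of_ne {W : Submodule ℝ (Fin 3 → ℝ)} {j : Fin 3}
    {c : ℝ} (hc : c ≠ 0) (h : Pi.single j c ∈ W) (d : ℝ) : Pi.single j d ∈ W := by
  have e : (Pi.single j d : Fin 3 → ℝ) = (d / c) • (Pi.single j c : Fin 3 → ℝ) := by
    rw [← Pi.single_smul', smul_eq_mul, div_mul_cancel₀ d hc]
  rw [e]
  exact W.smul_mem _ h

/-- The pair `{D, A}` (a fortiori the pencil `P`) is irreducible: a subspace of `ℝ³` invariant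
under `D = diag (0, 1, 2)` and `A = !![0, 1, 1; 2, 0, 1; 2, 2, 2]` is `⊥` or `⊤`. [folklore] -/
theorem permanentalCones_highLayer_irreducible (W : Submodule ℝ (Fin 3 → ℝ))
    (hD : ∀ v ∈ W, (!![0, 0, 0; 0, 1, 0; 0, 0, 2] : Matrix (Fin 3) (Fin 3) ℝ) *ᵥ v ∈ W)
    (hA : ∀ v ∈ W, (!![0, 1, 1; 2, 0, 1; 2, 2, 2] : Matrix (Fin 3) (Fin 3) ℝ) *ᵥ v ∈ W) :
    W = ⊥ ∨ W = ⊤ := by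
  refine or_iff_not_imp_left.2 fun hbot => ?_
  obtain ⟨v, hv, hv0⟩ := (Submodule.ne_bot_iff W).1 hbot
  obtain ⟨i, hi⟩ : ∃ i, v i ≠ 0 := Function.ne_iff.1 hv0
  -- the coordinate vector `eᵢ` lies in `W`
  have hei : Pi.single i (1 : ℝ) ∈ W :=
    permanentalCones_highLayer_single_mem_of_ne hi
      (permanentalCones_highLayer_single_mem W hD hv i) 1
  -- `u := A eᵢ + eᵢ ∈ W` (a column of `A + 1`) has all its coordinates nonzero
  have hu := W.add_mem (hA _ hei) hei
  have hu_ne : ∀ j, ((!![0, 1, 1; 2, 0, 1; 2, 2, 2] : Matrix (Fin 3) (Fin 3) ℝ) *ᵥ Pi.single i 1 +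
      Pi.single i 1 : Fin 3 → ℝ) j ≠ 0 := by
    intro j
    rw [Matrix.mulVec_single_one]
    fin_cases i <;> fin_cases j <;> norm_num
  -- hence every coordinate vector lies in `W`
  rw [Submodule.eq_top_iff']
  intro w
  rw [← Finset.univ_sum_single w]
  exact W.sum_mem fun j _ =>
    permanentalCones_highLayer_single_mem_of_ne (hu_ne j)
      (permanentalCones_highLayer_single_mem W hD hu j) (w j)

/-! ## No simultaneous symmetriser -/

/-- No positive definite `S` makes both `S D` and `S A` symmetric (`D = diag (0, 1, 2)`,
`A = !![0, 1, 1; 2, 0, 1; 2, 2, 2]`): `S D` symmetric forces the off-diagonal entries of `S` to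
vanish, then `S A` symmetric forces `S₂₂ = 0 < S₂₂`. [folklore] -/
theorem permanentalCones_highLayer_not_symmetrisable (S : Matrix (Fin 3) (Fin 3) ℝ)
    (hS : S.PosDef) (hSD : (S * !![0, 0, 0; 0, 1, 0; 0, 0, 2]).IsSymm)
    (hSA : (S * !![0, 1, 1; 2, 0, 1; 2, 2, 2]).IsSymm) : False := by
  have hsymm : S.IsSymm := Matrix.isHermitian_iff_isSymm.1 hS.isHermitian
  have hpos : 0 < S 2 2 := hS.diag_pos
  have g01 := hsymm.apply 0 1
  have g02 := hsymm.apply 0 2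
  have g12 := hsymm.apply 1 2
  have e01 := hSD.apply 0 1
  have e02 := hSD.apply 0 2
  have e12 := hSD.apply 1 2
  have f01 := hSA.apply 0 1
  have f02 := hSA.apply 0 2
  have f12 := hSA.apply 1 2
  simp only [Fin.isValue, Matrix.mul_apply, of_apply, cons_val', cons_val_zero, cons_val_fin_one,
    Fin.sum_univ_three, mul_zero, cons_val_one, add_zero, cons_val, mul_one, zero_add, zero_eq_mul,
    OfNat.ofNat_ne_zero, or_false] at e01 e02 e12 f01 f02 f12
  linarith

/-! ## Dimension of the span -/

/-- `1, D, A, B` are linearly independent. [folklore] -/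
theorem permanentalCones_highLayer_linearIndependent :
    LinearIndependent ℝ ![(1 : Matrix (Fin 3) (Fin 3) ℝ), !![0, 0, 0; 0, 1, 0; 0, 0, 2],
      !![0, 1, 1; 2, 0, 1; 2, 2, 2], !![0, 0, 0; -2, 0, -1; 4, 0, 2]] := by
  rw [Fintype.linearIndependent_iff]
  intro g hg i
  have h00 := congr_fun (congr_fun hg 0) 0
  have h01 := congr_fun (congr_fun hg 0) 1
  have h10 := congr_fun (congr_fun hg 1) 0
  have h11 := congr_fun (congr_fun hg 1) 1
  simp only [Nat.succ_eq_add_one, Nat.reduceAdd, Fin.isValue, Matrix.sum_apply, Matrix.smul_apply,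
    smul_eq_mul, Fin.sum_univ_four, cons_val_zero, one_apply_eq, mul_one, cons_val_one, of_apply,
    cons_val', cons_val_fin_one, mul_zero, add_zero, cons_val, Matrix.zero_apply, ne_eq,
    zero_ne_one, not_false_eq_true, one_apply_ne, zero_add, one_ne_zero, mul_neg] at h00 h01 h10 h11
  -- `h00 : g 0 = 0`, `h01 : g 2 = 0`, `h10 : 2 g 2 - 2 g 3 = 0`, `h11 : g 0 + g 1 = 0`
  have g0 : g 0 = 0 := by linarith
  have g1 : g 1 = 0 := by linarith
  have g2 : g 2 = 0 := by linarith
  have g3 : g 3 = 0 := by linarith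
  fin_cases i
  exacts [g0, g1, g2, g3]

/-- `3 < dim span ({1} ∪ range P)` for the pencil `P = Fintype.linearCombination ℝ ![D, A, B]`.
[folklore] -/
theorem permanentalCones_highLayer_finrank :
    3 < Module.finrank ℝ (Submodule.span ℝ (insert (1 : Matrix (Fin 3) (Fin 3) ℝ) (Set.range
      (Fintype.linearCombination ℝ ![(!![0, 0, 0; 0, 1, 0; 0, 0, 2] : Matrix (Fin 3) (Fin 3) ℝ),
        !![0, 1, 1; 2, 0, 1; 2, 2, 2], !![0, 0, 0; -2, 0, -1; 4, 0, 2]])))) := by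
  set V := Submodule.span ℝ (insert (1 : Matrix (Fin 3) (Fin 3) ℝ) (Set.range
    (Fintype.linearCombination ℝ ![(!![0, 0, 0; 0, 1, 0; 0, 0, 2] : Matrix (Fin 3) (Fin 3) ℝ),
      !![0, 1, 1; 2, 0, 1; 2, 2, 2], !![0, 0, 0; -2, 0, -1; 4, 0, 2]])))
  have hmem : ∀ i, ![(1 : Matrix (Fin 3) (Fin 3) ℝ), !![0, 0, 0; 0, 1, 0; 0, 0, 2],
      !![0, 1, 1; 2, 0, 1; 2, 2, 2], !![0, 0, 0; -2, 0, -1; 4, 0, 2]] i ∈ V := by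
    intro i
    apply Submodule.subset_span
    fin_cases i
    · exact Set.mem_insert _ _
    · exact Set.mem_insert_of_mem _ ⟨Pi.single 0 1, by simp⟩
    · exact Set.mem_insert_of_mem _ ⟨Pi.single 1 1, by simp⟩
    · exact Set.mem_insert_of_mem _ ⟨Pi.single 2 1, by simp⟩
  have hli : LinearIndependent ℝ (fun i => (⟨_, hmem i⟩ : V)) := by
    refine LinearIndependent.of_comp V.subtype ?_
    exact permanentalCones_highLayer_linearIndependent
  have h4 := hli.fintype_card_le_finrank
  rw [Fintype.card_fin] at h4
  omega

/-! ## The stub -/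

/-- **Stub E (the high layer is inhabited at `N = 3`).** There is a linear pencil `P` of real
`3 × 3` matrices with only real eigenvalues, irreducible, not simultaneously symmetrisable, with
`3 < dim span ({1} ∪ range P)`, whose closed nonnegative-spectrum cone
`{x : ∀ τ > 0, det (P x + τ·1) ≠ 0}` is nevertheless a spectrahedron of size `3`. The witness is
`P x = x₀ D + x₁ A + x₂ B` above, with symmetric determinantal certificate `L`. [folklore] -/
theorem stub_highLayer_inhabited :
    ∃ P : (Fin 3 → ℝ) →ₗ[ℝ] Matrix (Fin 3) (Fin 3) ℝ,
      (∀ (x : Fin 3 → ℝ) (z : ℂ),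
        ((P x).map (algebraMap ℝ ℂ) - z • (1 : Matrix (Fin 3) (Fin 3) ℂ)).det = 0 → z.im = 0) ∧
      (∀ W : Submodule ℝ (Fin 3 → ℝ), (∀ (x : Fin 3 → ℝ), ∀ v ∈ W, Matrix.mulVec (P x) v ∈ W) →
        W = ⊥ ∨ W = ⊤) ∧
      (¬ ∃ S : Matrix (Fin 3) (Fin 3) ℝ, S.PosDef ∧ ∀ x : Fin 3 → ℝ, (S * P x).IsSymm) ∧
      3 < Module.finrank ℝ (Submodule.span ℝ
        (insert (1 : Matrix (Fin 3) (Fin 3) ℝ) (Set.range P))) ∧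
      Literature.AlgebraicGeometry.HyperbolicPolynomials.IsSpectrahedralShadowOfSize
        {x : Fin 3 → ℝ | ∀ τ : ℝ, 0 < τ → (P x + τ • (1 : Matrix (Fin 3) (Fin 3) ℝ)).det ≠ 0} 3 := by
  refine ⟨Fintype.linearCombination ℝ ![(!![0, 0, 0; 0, 1, 0; 0, 0, 2] : Matrix (Fin 3) (Fin 3) ℝ),
    !![0, 1, 1; 2, 0, 1; 2, 2, 2], !![0, 0, 0; -2, 0, -1; 4, 0, 2]], ?_, ?_, ?_,
    permanentalCones_highLayer_finrank, ?_⟩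
  · -- real spectrum: transfer to the symmetric pencil `L` through the certificate
    intro x z hz
    rw [permanentalCones_highLayer_P_apply, permanentalCones_highLayer_det_map_eq] at hz
    exact permanentalCones_im_eq_zero_of_isSymm (permanentalCones_highLayer_L_isSymm x) hz
  · -- irreducible: already `D = P e₀` and `A = P e₁` have no common invariant subspace
    intro W hW
    refine permanentalCones_highLayer_irreducible W (fun v hv => ?_) (fun v hv => ?_)
    · simpa only [Fintype.linearCombination_apply_single, one_smul, cons_val_zero] using
        hW (Pi.single 0 1) v hv
    · simpa only [Fintype.linearCombination_apply_single, one_smul, cons_val_one, cons_val_zero]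
        using hW (Pi.single 1 1) v hv
  · -- not simultaneously symmetrisable
    rintro ⟨S, hS, hsym⟩
    refine permanentalCones_highLayer_not_symmetrisable S hS ?_ ?_
    · simpa only [Fintype.linearCombination_apply_single, one_smul, cons_val_zero] using
        hsym (Pi.single 0 1)
    · simpa only [Fintype.linearCombination_apply_single, one_smul, cons_val_one, cons_val_zero]
        using hsym (Pi.single 1 1)
  · -- a spectrahedron of size 3, by the symmetric determinantal certificate
    refine stub_spectrahedron_of_symmDetIdentity 3 3 _
      (Fintype.linearCombination ℝ ![(!![0, 0, 0; 0, 1, 0; 0, 0, 2] : Matrix (Fin 3) (Fin 3) ℝ),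
        !![0, 1, 2; 1, 0, 1; 2, 1, 2], !![0, 0, 0; 0, 0, 0; 0, 0, 2]])
      (fun x => ?_) (fun x τ => ?_)
    · rw [permanentalCones_highLayer_L_apply]
      exact permanentalCones_highLayer_L_isSymm x
    · rw [permanentalCones_highLayer_P_apply, permanentalCones_highLayer_L_apply]
      exact permanentalCones_highLayer_det_eq x τ

end Summit.ValiantsHypothesis.ValiantsHypothesis.Theorems
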